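import Summits.QuantumFields.QCD.Theorems.SmallFieldUltracontractivity.Negative.Tightness
import Summits.QuantumFields.QCD.Theorems.HeatSlicedQuarksSmallFieldUltracontractivityStubDiagonalMonotone
import Literature.Probability.LatticeModels.TorusFourierProofs

/-!
# Stub `stub_heatRowCalculus` of line `point-centred-axial-parabolic`
(crux `Summit.QuantumFields.QCD.Theses.HeatSlicedQuarks.SmallFieldUltracontractivity`, item stmt-QuantumFields-8871)

Three general linear-algebra facts about the rows of the heat kernel `P_τ = exp(-τ·AᴴA)` of the
positive matrix `H = AᴴA`, for an arbitrary complex square matrix `A`.  Everything follows from the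
spectral theorem `H = U diag(λ) U*` (`U` unitary, `λ ≥ 0`), `P_τ = U diag(e^{-τλ}) U*`:

1. **contraction** — for every row vector `w` and every `τ ≥ 0`, `‖w P_τ‖₂ ≤ ‖w‖₂`: `P_τ` is
   Hermitian, so `w P_τ = conj (P_τ w̄)` entrywise, and `‖P_τ v‖² = v† P_{2τ} v = Σ_k e^{-2τλ_k} |(U* v)_k|²
   ≤ ‖U* v‖² = ‖v‖²`;
2. **monotonicity** — `Σ_j |P_τ(i,j)|² = P_{2τ}(i,i)` (T*T identity) is non-increasing in `τ ≥ 0`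
   by the diagonal monotonicity `stub_diagonalMonotone` (whose spectral formula
   `re_exp_neg_smul_apply_self_eq_sum` for `P_t(i,i)` is reused below);
3. **the `Q`-trick** — if `Γ` is diagonal with unimodular diagonal, `Γ² = 1` and `Γ A Γ = Aᴴ`
   (`γ₅`-hermiticity), then `Γ_ii = ±1`, `Γᴴ = Γ`, `Q := Γ A` is Hermitian with `Q² = AᴴA = H` and
   `A = Γ Q`; hence `Σ_j |(A P_τ)(i,j)|² = Σ_j |(Q P_τ)(i,j)|² = (H P_{2τ})(i,i)
   = Σ_k |U_ik|² λ_k e^{-2τλ_k} ≤ (eτ)⁻¹ Σ_k |U_ik|² e^{-τλ_k} = (eτ)⁻¹ P_τ(i,i) = (eτ)⁻¹ Σ_j |P_{τ/2}(i,j)|²`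
   by the scalar bound `λ e^{-τλ} ≤ (eτ)⁻¹` (`e·x ≤ eˣ`). [folklore]
-/

noncomputable section

namespace Summit.QuantumFields.QCD.Cruxes.SmallFieldUltracontractivity.PointCentredAxialParabolic

open Literature.MathematicalPhysics.QuantumLattice Literature.MathematicalPhysics.QuantumFieldTheory
open Literature.Probability.LatticeModels (TorusSite torusChar)
open Summit.QuantumFields.QCD.Theorems.SmallFieldUltracontractivity.Negative
open scoped Matrix ComplexConjugate ComplexOrder

namespace HeatRowCalculus

variable {ι : Type*} [Fintype ι] [DecidableEq ι]

/-! ### Spectral calculus for `AᴴA` and its heat kernel -/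

/-- **Spectral decompositions** of `H = AᴴA` and of `exp(-t·H)` through the same eigenvector unitary
`U` of `H`: `H = U diag(λ) U*` and `exp(-t·H) = U diag(e^{-tλ}) U*`. -/
theorem spectral_pair (A : Matrix ι ι ℂ) (hH : (Aᴴ * A).IsHermitian) (t : ℝ) :
    Aᴴ * A = (hH.eigenvectorUnitary : Matrix ι ι ℂ) *
        Matrix.diagonal (fun k => ((hH.eigenvalues k : ℝ) : ℂ)) *
          star (hH.eigenvectorUnitary : Matrix ι ι ℂ) ∧
      NormedSpace.exp (-(t : ℂ) • (Aᴴ * A)) = (hH.eigenvectorUnitary : Matrix ι ι ℂ) *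
        Matrix.diagonal (fun k => ((Real.exp (-(t * hH.eigenvalues k)) : ℝ) : ℂ)) *
          star (hH.eigenvectorUnitary : Matrix ι ι ℂ) := by
  -- adapted from `norm_exp_neg_smul_conjTranspose_mul_self_apply_le_one` (Negative/LoadBearing)
  set U : Matrix ι ι ℂ := (hH.eigenvectorUnitary : Matrix ι ι ℂ) with hUdef
  have hUu : star U * U = 1 := Unitary.coe_star_mul_self hH.eigenvectorUnitary
  set w : ι → ℂ := fun k => Complex.exp (-(t : ℂ) * ((hH.eigenvalues k : ℝ) : ℂ)) with hw
  have h0 : Aᴴ * A = U * Matrix.diagonal (fun k => ((hH.eigenvalues k : ℝ) : ℂ)) * star U := by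
    conv_lhs => rw [hH.spectral_theorem, Unitary.conjStarAlgAut_apply]
    rfl
  refine ⟨h0, ?_⟩
  have hspec : -(t : ℂ) • (Aᴴ * A) =
      U * Matrix.diagonal (fun k => -(t : ℂ) * ((hH.eigenvalues k : ℝ) : ℂ)) * star U := by
    conv_lhs => rw [h0]
    rw [← Matrix.smul_mul, ← Matrix.mul_smul, ← Matrix.diagonal_smul]
    rfl
  have hinv : U⁻¹ = star U := Matrix.inv_eq_left_inv hUu
  have hunit : IsUnit U := by
    rw [Matrix.isUnit_iff_isUnit_det]
    exact Matrix.isUnit_det_of_left_inverse hUu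
  have hwexp : NormedSpace.exp (fun k => -(t : ℂ) * ((hH.eigenvalues k : ℝ) : ℂ)) = w := by
    funext k
    rw [Pi.coe_exp, hw, Complex.exp_eq_exp_ℂ]
  have hwk : w = fun k => ((Real.exp (-(t * hH.eigenvalues k)) : ℝ) : ℂ) := by
    funext k
    rw [hw, Complex.ofReal_exp]
    push_cast
    rw [← neg_mul]
  rw [hspec, ← hinv, Matrix.exp_conj _ _ hunit, Matrix.exp_diagonal, hwexp, hwk]

/-- Diagonal entries of `U diag(f) U*`: `(U diag(f) U*)(i,i) = Σ_k |U(i,k)|² f(k)`. -/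
theorem conj_diagonal_apply_self (U : Matrix ι ι ℂ) (f : ι → ℂ) (i : ι) :
    (U * Matrix.diagonal f * star U) i i = ∑ k, ((‖U i k‖ ^ 2 : ℝ) : ℂ) * f k := by
  rw [Matrix.mul_apply]
  refine Finset.sum_congr rfl fun k _ => ?_
  rw [Matrix.mul_diagonal, Matrix.star_apply, mul_right_comm, Complex.star_def, Complex.mul_conj,
    Complex.normSq_eq_norm_sq]

/-- `Re (AᴴA · exp(-t·AᴴA))(i,i) = Σ_k |U(i,k)|² λ_k e^{-tλ_k}` (companion of
`re_exp_neg_smul_apply_self_eq_sum`, which is the case without the factor `AᴴA`). -/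
theorem re_mul_exp_apply_self (A : Matrix ι ι ℂ) (hH : (Aᴴ * A).IsHermitian) (t : ℝ) (i : ι) :
    ((Aᴴ * A * NormedSpace.exp (-(t : ℂ) • (Aᴴ * A))) i i).re =
      ∑ k, ‖(hH.eigenvectorUnitary : Matrix ι ι ℂ) i k‖ ^ 2 *
        (hH.eigenvalues k * Real.exp (-(t * hH.eigenvalues k))) := by
  obtain ⟨h0, hexp⟩ := spectral_pair A hH t
  set U : Matrix ι ι ℂ := (hH.eigenvectorUnitary : Matrix ι ι ℂ) with hUdef
  have hUu : star U * U = 1 := Unitary.coe_star_mul_self hH.eigenvectorUnitary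
  set Dl : Matrix ι ι ℂ := Matrix.diagonal (fun k => ((hH.eigenvalues k : ℝ) : ℂ)) with hDl
  set Dw : Matrix ι ι ℂ :=
    Matrix.diagonal (fun k => ((Real.exp (-(t * hH.eigenvalues k)) : ℝ) : ℂ)) with hDw
  have hprod : Aᴴ * A * NormedSpace.exp (-(t : ℂ) • (Aᴴ * A)) =
      U * Matrix.diagonal (fun k => ((hH.eigenvalues k : ℝ) : ℂ) *
        ((Real.exp (-(t * hH.eigenvalues k)) : ℝ) : ℂ)) * star U := by
    rw [hexp]
    calc Aᴴ * A * (U * Dw * star U) = U * Dl * star U * (U * Dw * star U) := by rw [h0]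
      _ = U * (Dl * (star U * U) * Dw) * star U := by simp only [Matrix.mul_assoc]
      _ = U * (Dl * Dw) * star U := by rw [hUu, Matrix.mul_one]
      _ = _ := by rw [hDl, hDw, Matrix.diagonal_mul_diagonal]
  rw [hprod, conj_diagonal_apply_self, Complex.re_sum]
  simp only [Complex.re_ofReal_mul, Complex.ofReal_re]

omit [DecidableEq ι] in
/-- `Re (y† y) = Σ_j |y_j|²`. -/
theorem re_star_dotProduct_self (y : ι → ℂ) : (star y ⬝ᵥ y).re = ∑ j, ‖y j‖ ^ 2 := by
  rw [dotProduct, Complex.re_sum]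
  refine Finset.sum_congr rfl fun j _ => ?_
  rw [Pi.star_apply, Complex.star_def, Complex.conj_mul', ← Complex.ofReal_pow, Complex.ofReal_re]

/-! ### (1) Contraction of the heat semigroup in `ℓ²` -/

/-- **`ℓ²`-contraction on column vectors**: `Σ_j |(P_τ v)_j|² ≤ Σ_i |v_i|²` for `τ ≥ 0`, where
`P_τ = exp(-τ·AᴴA)` (`‖P_τ v‖² = v† P_{2τ} v = Σ_k e^{-2τλ_k} |(U*v)_k|² ≤ ‖U* v‖² = ‖v‖²`). -/
theorem sum_norm_sq_exp_mulVec_le (A : Matrix ι ι ℂ) (v : ι → ℂ) {τ : ℝ} (hτ : 0 ≤ τ) :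
    ∑ j, ‖(NormedSpace.exp (-(τ : ℂ) • (Aᴴ * A)) *ᵥ v) j‖ ^ 2 ≤ ∑ i, ‖v i‖ ^ 2 := by
  have hP : (Aᴴ * A).PosSemidef := Matrix.posSemidef_conjTranspose_mul_self A
  have hH : (Aᴴ * A).IsHermitian := hP.isHermitian
  have hexp := (spectral_pair A hH (2 * τ)).2
  set U : Matrix ι ι ℂ := (hH.eigenvectorUnitary : Matrix ι ι ℂ) with hUdef
  have hUu' : U * star U = 1 := Unitary.coe_mul_star_self hH.eigenvectorUnitary
  set D : Matrix ι ι ℂ :=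
    Matrix.diagonal (fun k => ((Real.exp (-(2 * τ * hH.eigenvalues k)) : ℝ) : ℂ)) with hD
  set P : Matrix ι ι ℂ := NormedSpace.exp (-(τ : ℂ) • (Aᴴ * A)) with hPdef
  have hPh : P.IsHermitian := isHermitian_exp_neg_smul A τ
  -- semigroup law and spectral form of `P * P`
  have hPP : P * P = U * D * star U := by
    rw [← hexp, hPdef, ← Matrix.exp_add_of_commute _ _ (Commute.refl _), ← add_smul]
    congr 2
    push_cast
    ring
  set z : ι → ℂ := star U *ᵥ v with hz
  have hz' : star z = star v ᵥ* U := by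
    rw [hz, Matrix.star_mulVec, Matrix.star_eq_conjTranspose, Matrix.conjTranspose_conjTranspose]
  -- `‖P v‖² = z† D z`
  have h1 : star (P *ᵥ v) ⬝ᵥ (P *ᵥ v) = star z ⬝ᵥ (D *ᵥ z) := by
    rw [Matrix.star_mulVec, hPh.eq, ← Matrix.dotProduct_mulVec, Matrix.mulVec_mulVec, hPP,
      ← Matrix.mulVec_mulVec, ← Matrix.mulVec_mulVec, Matrix.dotProduct_mulVec, ← hz', ← hz]
  -- `‖v‖² = z† z`
  have h2 : star v ⬝ᵥ v = star z ⬝ᵥ z := by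
    rw [hz', ← Matrix.dotProduct_mulVec, hz, Matrix.mulVec_mulVec, hUu', Matrix.one_mulVec]
  have h3 : (star z ⬝ᵥ (D *ᵥ z)).re =
      ∑ k, Real.exp (-(2 * τ * hH.eigenvalues k)) * ‖z k‖ ^ 2 := by
    rw [dotProduct, Complex.re_sum]
    refine Finset.sum_congr rfl fun k _ => ?_
    rw [hD, Matrix.mulVec_diagonal, Pi.star_apply, mul_left_comm, Complex.star_def,
      Complex.conj_mul', ← Complex.ofReal_pow, ← Complex.ofReal_mul, Complex.ofReal_re]
  rw [← re_star_dotProduct_self, ← re_star_dotProduct_self v, h1, h2, h3, re_star_dotProduct_self]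
  refine Finset.sum_le_sum fun k _ => ?_
  have hk : 0 ≤ hH.eigenvalues k := hP.eigenvalues_nonneg k
  have hle : Real.exp (-(2 * τ * hH.eigenvalues k)) ≤ 1 := by
    rw [Real.exp_le_one_iff, neg_nonpos]
    positivity
  calc Real.exp (-(2 * τ * hH.eigenvalues k)) * ‖z k‖ ^ 2 ≤ 1 * ‖z k‖ ^ 2 := by gcongr
    _ = ‖z k‖ ^ 2 := one_mul _

/-- **`ℓ²`-contraction on row vectors**: `Σ_j |Σ_i w_i P_τ(i,j)|² ≤ Σ_i |w_i|²` for `τ ≥ 0`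
(`P_τ` is Hermitian, so `w P_τ = conj (P_τ w̄)` entrywise). -/
theorem sum_norm_sq_vecMul_exp_le (A : Matrix ι ι ℂ) (w : ι → ℂ) {τ : ℝ} (hτ : 0 ≤ τ) :
    ∑ j, ‖∑ i, w i * (NormedSpace.exp (-(τ : ℂ) • (Aᴴ * A))) i j‖ ^ 2 ≤ ∑ i, ‖w i‖ ^ 2 := by
  set P : Matrix ι ι ℂ := NormedSpace.exp (-(τ : ℂ) • (Aᴴ * A)) with hP
  have hPh : P.IsHermitian := isHermitian_exp_neg_smul A τ
  have key : ∀ j, ‖∑ i, w i * P i j‖ = ‖(P *ᵥ star w) j‖ := by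
    intro j
    rw [← norm_star (∑ i, w i * P i j)]
    congr 1
    simp only [Matrix.mulVec, dotProduct, star_sum, star_mul, Pi.star_apply]
    refine Finset.sum_congr rfl fun i _ => ?_
    rw [hPh.apply j i]
  have hw : ∀ i, ‖(star w) i‖ = ‖w i‖ := fun i => by rw [Pi.star_apply, norm_star]
  calc ∑ j, ‖∑ i, w i * P i j‖ ^ 2 = ∑ j, ‖(P *ᵥ star w) j‖ ^ 2 := by simp_rw [key]
    _ ≤ ∑ i, ‖(star w) i‖ ^ 2 := sum_norm_sq_exp_mulVec_le A (star w) hτ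
    _ = ∑ i, ‖w i‖ ^ 2 := by simp_rw [hw]

/-! ### (2) Squared row norms are diagonal entries at doubled time -/

/-- `Σ_j |P_τ(i,j)|² = Re P_{2τ}(i,i)` (the T*T identity `exp_neg_smul_apply_self_eq_sum_norm_sq`). -/
theorem sum_norm_sq_exp_row_eq_re (A : Matrix ι ι ℂ) (τ : ℝ) (i : ι) :
    ∑ j, ‖(NormedSpace.exp (-(τ : ℂ) • (Aᴴ * A))) i j‖ ^ 2 =
      ((NormedSpace.exp (-((2 * τ : ℝ) : ℂ) • (Aᴴ * A))) i i).re := by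
  have h := exp_neg_smul_apply_self_eq_sum_norm_sq A (2 * τ) i
  rw [show (2 * τ / 2 : ℝ) = τ by ring] at h
  rw [h, ← Complex.ofReal_sum, Complex.ofReal_re]

/-! ### (3) The `Q`-trick -/

omit [DecidableEq ι] in
/-- Squared row norms are diagonal entries of `M Mᴴ`: `(M Mᴴ)(i,i) = Σ_j |M(i,j)|²`. -/
theorem mul_conjTranspose_apply_self (M : Matrix ι ι ℂ) (i : ι) :
    (M * Mᴴ) i i = ∑ j, ((‖M i j‖ ^ 2 : ℝ) : ℂ) := by
  rw [Matrix.mul_apply]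
  refine Finset.sum_congr rfl fun j _ => ?_
  rw [Matrix.conjTranspose_apply, Complex.star_def, Complex.mul_conj, Complex.normSq_eq_norm_sq]

/-- The scalar bound behind the `Q`-trick: `x e^{-τx} ≤ (eτ)⁻¹` for real `x` and `τ > 0`
(`e·y ≤ eʸ` with `y = τx`). -/
theorem mul_exp_neg_mul_le (x : ℝ) {τ : ℝ} (hτ : 0 < τ) :
    x * Real.exp (-(τ * x)) ≤ 1 / (Real.exp 1 * τ) := by
  have key : Real.exp 1 * τ * x ≤ Real.exp (τ * x) := by
    have h := Real.add_one_le_exp (τ * x - 1)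
    rw [Real.exp_sub, le_div_iff₀ (Real.exp_pos 1)] at h
    nlinarith [h]
  have hE : 0 ≤ Real.exp (-(τ * x)) := (Real.exp_pos _).le
  have h1 : Real.exp (τ * x) * Real.exp (-(τ * x)) = 1 := by
    rw [← Real.exp_add, add_neg_cancel, Real.exp_zero]
  rw [le_div_iff₀ (by positivity)]
  calc x * Real.exp (-(τ * x)) * (Real.exp 1 * τ)
      = Real.exp 1 * τ * x * Real.exp (-(τ * x)) := by ring
    _ ≤ Real.exp (τ * x) * Real.exp (-(τ * x)) := mul_le_mul_of_nonneg_right key hE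
    _ = 1 := h1

/-- **Hermitian form of the `Q`-trick.** For a Hermitian matrix `Q` (so `QᴴQ = Q²`), every index `i`
and every `τ > 0`: `Σ_j |(Q e^{-τQ²})(i,j)|² ≤ (eτ)⁻¹ Σ_j |e^{-(τ/2)Q²}(i,j)|²`. -/
theorem sum_norm_sq_hermitian_mul_exp_row_le (Q : Matrix ι ι ℂ) (hQ : Qᴴ = Q) (i : ι) {τ : ℝ}
    (hτ : 0 < τ) :
    ∑ j, ‖(Q * NormedSpace.exp (-(τ : ℂ) • (Qᴴ * Q))) i j‖ ^ 2 ≤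
      1 / (Real.exp 1 * τ) *
        ∑ j, ‖(NormedSpace.exp (-((τ / 2 : ℝ) : ℂ) • (Qᴴ * Q))) i j‖ ^ 2 := by
  have hP : (Qᴴ * Q).PosSemidef := Matrix.posSemidef_conjTranspose_mul_self Q
  have hH : (Qᴴ * Q).IsHermitian := hP.isHermitian
  set P : Matrix ι ι ℂ := NormedSpace.exp (-(τ : ℂ) • (Qᴴ * Q)) with hPdef
  set P₂ : Matrix ι ι ℂ := NormedSpace.exp (-((2 * τ : ℝ) : ℂ) • (Qᴴ * Q)) with hP₂def
  have hPh : P.IsHermitian := isHermitian_exp_neg_smul Q τ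
  -- semigroup law `P * P = P₂`
  have hPP : P * P = P₂ := by
    rw [hP₂def, hPdef, ← Matrix.exp_add_of_commute _ _ (Commute.refl _), ← add_smul]
    congr 2
    push_cast
    ring
  -- `Q` commutes with `P₂`
  have hc : Commute Q (Qᴴ * Q) := by
    rw [hQ]
    exact (Commute.refl Q).mul_right (Commute.refl Q)
  have hc₂ : Commute Q P₂ := (hc.smul_right _).exp_right
  -- `Y Yᴴ = H P₂` for `Y = Q P`
  have hYY : Q * P * (Q * P)ᴴ = Qᴴ * Q * P₂ := by
    rw [Matrix.conjTranspose_mul, hPh.eq, hQ]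
    calc Q * P * (P * Q) = Q * (P * P) * Q := by simp only [Matrix.mul_assoc]
      _ = Q * Q * P₂ := by rw [hPP, Matrix.mul_assoc, ← hc₂.eq, ← Matrix.mul_assoc]
  -- left-hand side in spectral form
  have hL : ∑ j, ‖(Q * P) i j‖ ^ 2 =
      ∑ k, ‖(hH.eigenvectorUnitary : Matrix ι ι ℂ) i k‖ ^ 2 *
        (hH.eigenvalues k * Real.exp (-(2 * τ * hH.eigenvalues k))) := by
    have h1 : ((∑ j, ((‖(Q * P) i j‖ ^ 2 : ℝ) : ℂ)) : ℂ).re = ((Qᴴ * Q * P₂) i i).re := by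
      rw [← mul_conjTranspose_apply_self, hYY]
    rw [← Complex.ofReal_sum, Complex.ofReal_re] at h1
    rw [h1, hP₂def, re_mul_exp_apply_self Q hH (2 * τ) i]
  -- right-hand side in spectral form
  have hR : ∑ j, ‖(NormedSpace.exp (-((τ / 2 : ℝ) : ℂ) • (Qᴴ * Q))) i j‖ ^ 2 =
      ∑ k, ‖(hH.eigenvectorUnitary : Matrix ι ι ℂ) i k‖ ^ 2 *
        Real.exp (-(τ * hH.eigenvalues k)) := by
    have h1 := congrArg Complex.re (exp_neg_smul_apply_self_eq_sum_norm_sq Q τ i)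
    rw [← Complex.ofReal_sum, Complex.ofReal_re] at h1
    rw [← h1, re_exp_neg_smul_apply_self_eq_sum Q hH τ i]
  rw [hL, hR, Finset.mul_sum]
  refine Finset.sum_le_sum fun k _ => ?_
  have hsc := mul_exp_neg_mul_le (hH.eigenvalues k) hτ
  have hsplit : Real.exp (-(2 * τ * hH.eigenvalues k)) =
      Real.exp (-(τ * hH.eigenvalues k)) * Real.exp (-(τ * hH.eigenvalues k)) := by
    rw [← Real.exp_add]
    ring_nf
  rw [hsplit]
  have hU : 0 ≤ ‖(hH.eigenvectorUnitary : Matrix ι ι ℂ) i k‖ ^ 2 := sq_nonneg _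
  have hE : 0 ≤ Real.exp (-(τ * hH.eigenvalues k)) := (Real.exp_pos _).le
  calc ‖(hH.eigenvectorUnitary : Matrix ι ι ℂ) i k‖ ^ 2 *
        (hH.eigenvalues k * (Real.exp (-(τ * hH.eigenvalues k)) *
          Real.exp (-(τ * hH.eigenvalues k))))
      = ‖(hH.eigenvectorUnitary : Matrix ι ι ℂ) i k‖ ^ 2 * Real.exp (-(τ * hH.eigenvalues k)) *
          (hH.eigenvalues k * Real.exp (-(τ * hH.eigenvalues k))) := by ring
    _ ≤ ‖(hH.eigenvectorUnitary : Matrix ι ι ℂ) i k‖ ^ 2 * Real.exp (-(τ * hH.eigenvalues k)) *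
          (1 / (Real.exp 1 * τ)) := mul_le_mul_of_nonneg_left hsc (mul_nonneg hU hE)
    _ = 1 / (Real.exp 1 * τ) *
          (‖(hH.eigenvectorUnitary : Matrix ι ι ℂ) i k‖ ^ 2 *
            Real.exp (-(τ * hH.eigenvalues k))) := by ring

omit [DecidableEq ι] in
/-- Rows of `Γ X` for an off-diagonally vanishing `Γ`: `(Γ X)(i,j) = Γ_ii X(i,j)`. -/
theorem offDiagZero_mul_apply (Γ X : Matrix ι ι ℂ) (hoff : ∀ i j, i ≠ j → Γ i j = 0) (i j : ι) :
    (Γ * X) i j = Γ i i * X i j := by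
  classical
  rw [Matrix.mul_apply, Finset.sum_eq_single i]
  · intro k _ hk
    rw [hoff i k (Ne.symm hk), zero_mul]
  · intro h
    exact absurd (Finset.mem_univ i) h

/-- A diagonal involution has diagonal entries `±1`, hence is Hermitian. -/
theorem conjTranspose_eq_self_of_involution (Γ : Matrix ι ι ℂ) (hΓ2 : Γ * Γ = 1)
    (hoff : ∀ i j, i ≠ j → Γ i j = 0) : Γᴴ = Γ := by
  have hsq : ∀ i, Γ i i * Γ i i = 1 := fun i => by
    have h := congr_fun (congr_fun hΓ2 i) i
    rwa [offDiagZero_mul_apply Γ Γ hoff, Matrix.one_apply_eq] at h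
  ext i j
  rw [Matrix.conjTranspose_apply]
  by_cases hij : i = j
  · subst hij
    rcases mul_self_eq_one_iff.mp (hsq i) with h | h <;> rw [h] <;> simp
  · rw [hoff i j hij, hoff j i (Ne.symm hij), star_zero]

end HeatRowCalculus

open HeatRowCalculus in
/-- **Row calculus of the heat kernel `P_τ = exp(-τ·AᴴA)`** (three general facts, any complex square
matrix `A`): (1) `ℓ²`-contraction on row vectors, `Σ_j |Σ_i w_i P_τ(i,j)|² ≤ Σ_i |w_i|²` for `τ ≥ 0`;
(2) monotonicity of squared row norms, `Σ_j |P_τ(i,j)|² ≤ Σ_j |P_τ'(i,j)|²` for `0 ≤ τ' ≤ τ`;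
(3) the `Q`-trick: if `Γ A Γ = Aᴴ`, `Γ² = 1`, `Γ` diagonal with unimodular diagonal, then for `τ > 0`
`Σ_j |(A P_τ)(i,j)|² ≤ (eτ)⁻¹ Σ_j |P_{τ/2}(i,j)|²`. -/
theorem stub_heatRowCalculus :
    (∀ (ι : Type) [Fintype ι] [DecidableEq ι] (A : Matrix ι ι ℂ) (w : ι → ℂ) (τ : ℝ), 0 ≤ τ →
        ∑ j, ‖∑ i, w i * (NormedSpace.exp (-(τ : ℂ) • (Aᴴ * A))) i j‖ ^ 2 ≤ ∑ i, ‖w i‖ ^ 2) ∧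
      (∀ (ι : Type) [Fintype ι] [DecidableEq ι] (A : Matrix ι ι ℂ) (i : ι) (τ' τ : ℝ), 0 ≤ τ' → τ' ≤ τ →
        ∑ j, ‖(NormedSpace.exp (-(τ : ℂ) • (Aᴴ * A))) i j‖ ^ 2 ≤
          ∑ j, ‖(NormedSpace.exp (-(τ' : ℂ) • (Aᴴ * A))) i j‖ ^ 2) ∧
      (∀ (ι : Type) [Fintype ι] [DecidableEq ι] (A Γ : Matrix ι ι ℂ), Γ * A * Γ = Aᴴ → Γ * Γ = 1 →
        (∀ i j, i ≠ j → Γ i j = 0) → (∀ i, ‖Γ i i‖ = 1) → ∀ (i : ι) (τ : ℝ), 0 < τ →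
        ∑ j, ‖(A * NormedSpace.exp (-(τ : ℂ) • (Aᴴ * A))) i j‖ ^ 2 ≤
          1 / (Real.exp 1 * τ) * ∑ j, ‖(NormedSpace.exp (-((τ / 2 : ℝ) : ℂ) • (Aᴴ * A))) i j‖ ^ 2) := by
  refine ⟨fun ι _ _ A w τ hτ => sum_norm_sq_vecMul_exp_le A w hτ, ?_, ?_⟩
  · intro ι _ _ A i τ' τ h0 hle
    rw [sum_norm_sq_exp_row_eq_re A τ i, sum_norm_sq_exp_row_eq_re A τ' i]
    exact stub_diagonalMonotone ι A i (2 * τ') (2 * τ) (by linarith) (by linarith)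
  intro ι _ _ A Γ hΓAΓ hΓ2 hoff hunit i τ hτ
  have hΓh : Γᴴ = Γ := conjTranspose_eq_self_of_involution Γ hΓ2 hoff
  set Q : Matrix ι ι ℂ := Γ * A with hQdef
  have hQh : Qᴴ = Q := by
    rw [hQdef, Matrix.conjTranspose_mul, hΓh, ← hΓAΓ, Matrix.mul_assoc, hΓ2, Matrix.mul_one]
  have hH : Aᴴ * A = Qᴴ * Q := by
    rw [hQh, hQdef, ← Matrix.mul_assoc, hΓAΓ]
  have hA : A = Γ * Q := by
    rw [hQdef, ← Matrix.mul_assoc, hΓ2, Matrix.one_mul]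
  have hrow : ∀ j, ‖(A * NormedSpace.exp (-(τ : ℂ) • (Aᴴ * A))) i j‖ =
      ‖(Q * NormedSpace.exp (-(τ : ℂ) • (Qᴴ * Q))) i j‖ := by
    intro j
    have e : A * NormedSpace.exp (-(τ : ℂ) • (Aᴴ * A)) =
        Γ * (Q * NormedSpace.exp (-(τ : ℂ) • (Qᴴ * Q))) := by
      rw [← Matrix.mul_assoc, ← hA, hH]
    rw [e, offDiagZero_mul_apply Γ _ hoff, norm_mul, hunit i, one_mul]
  simp_rw [hrow, hH]
  exact sum_norm_sq_hermitian_mul_exp_row_le Q hQh i hτ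

end Summit.QuantumFields.QCD.Cruxes.SmallFieldUltracontractivity.PointCentredAxialParabolic

end
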